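import Summits.CriticalPhenomena.SAWScalingLimit.Theorems.SAWDevelopingMapObservableToSLECanonicalTransferBoundaryExit
import Summits.CriticalPhenomena.SAWScalingLimit.Theorems.SAWDevelopingMapObservableToSLECanonicalTransferFamily
import HarnessLib

/-!
# Crux `SAWDevelopingMap.ObservableToSLE` (stmt-CriticalPhenomena-10472), line
`floor-ratio-restriction-bootstrap`, stub `stub_canonicalTransfer`: the fixed-scale lower bound
for the canonical insensitivity (CI)

Landing target:
`Summits/CriticalPhenomena/SAWScalingLimit/Theorems/SAWDevelopingMapObservableToSLECanonicalTransferCanonicalBound.lean`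
(`--supports stmt-CriticalPhenomena-10472`).  Sequel of `…CanonicalTransferBoundaryExit.lean`,
`…CanonicalTransferFamily.lean`, `…CanonicalTransferSqueeze(Pendant).lean`.

* `support_subset_of_closed` — at a fixed mesh, every canonical SAW of a floor domain stays in
  `L ∪ {a, b}` for any vertex set `L` closed under honeycomb steps to points of the domain of row
  `≥ m` and containing the rows `≥ m` near the first floor point;
* `sum_le_measure_inside_mul_sum` — **`Z_Λ(σa,σb) ≤ P^{can}(γ ⊆ Λ ∪ {a,b}) · Z_L(σa,σb)`** for an
  inner family `Λ ⊆ L` without bad edges (dictionary + outer injections, both floor cases);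
* `tendsto_one_of_ratio_squeeze_le` (= registered sub-goal `stub_canonicalTransfer_squeezeLe`).
-/

noncomputable section

open scoped Topology NNReal ENNReal
open Filter Set Metric MeasureTheory
open Literature.Probability.LatticeModels (HexVertex hexGraph hexCenter Site)
open Literature.Probability.RandomPlanarGeometry
open Literature.Probability.RandomPlanarGeometry.SAW
open Literature.Probability.Percolation (PathIn)

namespace Summit.CriticalPhenomena.SAWScalingLimit.Theorems.ObservableToSLE.FloorRatio

/-- **Canonical walks stay in a closed vertex set.**  At a fixed mesh, let `L` be a finite set
of vertices closed under honeycomb steps to points of `D` of row `≥ m` and containing the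
row-`≥ m` vertices within `ρ'` of the first floor point, where the canonical endpoint `a` and its
neighbours live.  Then every canonical SAW of `D_δ` from `a` to `b` has all its vertices in
`L ∪ {a, b}` (pendant floor vertices, of row `m - 1`, have a single neighbour in `D_δ` and cannot
be traversed). [folklore] -/
theorem support_subset_of_closed {D : DobrushinDomain} {δ ρ' : ℝ} {m : ℤ} {L : Finset HexVertex}
    {a b : HexVertex} (hδ : 0 < δ) (hDh : D.carrier ⊆ {z : ℂ | (D.pt 0).im < z.im})
    (hm1 : ((m : ℝ) - 2 / 3) * (δ * (Real.sqrt 3 / 2)) ≤ (D.pt 0).im)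
    (hcl : ∀ v ∈ L, ∀ w : HexVertex, (δ : ℂ) * hexCenter w ∈ D.carrier → m ≤ w.1 1 →
      hexGraph.Adj v w → w ∈ L)
    (hrows : ∀ v : HexVertex, (δ : ℂ) * hexCenter v ∈ ball (D.pt 0) ρ' → m ≤ v.1 1 → v ∈ L)
    (hBa : ∀ w : HexVertex, (w = a ∨ hexGraph.Adj a w) → (δ : ℂ) * hexCenter w ∈ ball (D.pt 0) ρ')
    (γ : HexDomainSAW D.carrier δ a b) : ∀ v ∈ γ.walk.support, v ∈ L ∨ v = a ∨ v = b := by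
  by_contra hIn
  push Not at hIn
  obtain ⟨u, hu, huL, hua, hub⟩ := hIn
  set R : Set HexVertex := (↑L : Set HexVertex) ∪ {a} with hR
  set p := γ.walk.takeUntil u hu with hp
  obtain ⟨d, hd, hd1, hd2⟩ := exists_dart_exit (R := R) p (Or.inr rfl) fun h =>
    h.elim (fun h => huL h) (fun h => hua h)
  have hdγ : d ∈ γ.walk.darts := γ.walk.darts_takeUntil_subset_darts hu hd
  set a' := d.fst with ha'
  set b' := d.snd with hb'
  have hadj : (hexDomainGraph D.carrier δ).Adj a' b' := d.adj
  obtain ⟨hmesh, ha'M, hb'M⟩ := (embDomainGraph_adj_iff _ _).1 hadj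
  have hhex : hexGraph.Adj a' b' := ((embMeshGraph_adj_iff _ _).1 hmesh).1
  have ha'D : (δ : ℂ) * hexCenter a' ∈ D.carrier := embMeshDomain_subset _ _ _ _ ha'M
  have hb'D : (δ : ℂ) * hexCenter b' ∈ D.carrier := embMeshDomain_subset _ _ _ _ hb'M
  have hb'p : b' ∈ p.support := p.dart_snd_mem_support_of_mem_darts hd
  have hb'supp : b' ∈ γ.walk.support := γ.walk.support_takeUntil_subset_support hu hb'p
  have hbp : b ∉ p.support := γ.walk.endpoint_notMem_support_takeUntil γ.isPath hu hub.symm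
  have hb'b : b' ≠ b := fun h => hbp (h ▸ hb'p)
  have hb'L : b' ∉ L := fun h => hd2 (Or.inl h)
  -- `b'` is below the floor row
  have hrow : ¬ m ≤ b'.1 1 := by
    intro hrow
    rcases hd1 with ha'L | ha'a
    · exact hb'L (hcl a' ha'L b' hb'D hrow hhex)
    · have ha'a : a' = a := ha'a
      exact hb'L (hrows b' (hBa b' (Or.inr (ha'a ▸ hhex))) hrow)
  -- a pendant floor vertex: the walk would retrace the edge to its only neighbour
  have hK : 0 < δ * (Real.sqrt 3 / 2) := by positivity
  have him : ∀ v : HexVertex, ((δ : ℂ) * hexCenter v).im =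
      ((v.1 1 : ℝ) + ((v.2 : ℕ) + 1) / 3) * (δ * (Real.sqrt 3 / 2)) := fun v => by
    rw [im_smul_hexCenter]; ring
  push Not at hrow
  have hrow' : (b'.1 1 : ℝ) + 1 ≤ m := by exact_mod_cast hrow
  have hb'im : (D.pt 0).im < ((δ : ℂ) * hexCenter b').im := hDh hb'D
  obtain ⟨x, k⟩ := b'
  have hk : k = 1 := by
    fin_cases k
    · exfalso
      rw [him] at hb'im
      norm_num at hb'im hrow'
      nlinarith
    · rfl
  subst hk
  have hx0 : ((δ : ℂ) * hexCenter (x, (0 : Fin 2))).im ≤ (D.pt 0).im := by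
    rw [him]
    simp only [Fin.val_zero, Nat.cast_zero, zero_add]
    simp only at hrow'
    nlinarith
  have ha'eq : a' = (x + Pi.single 1 1, 0) := floor_pendant_neighbour hδ hx0 hhex.symm (hDh ha'D)
  obtain ⟨d', hd', hd'1⟩ := exists_dart_fst_eq γ.walk hb'supp hb'b
  have hadj' : (hexDomainGraph D.carrier δ).Adj (x, (1 : Fin 2)) d'.snd := hd'1 ▸ d'.adj
  obtain ⟨hmesh', -, hcM⟩ := (embDomainGraph_adj_iff _ _).1 hadj'
  have hceq : d'.snd = (x + Pi.single 1 1, 0) := floor_pendant_neighbour hδ hx0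
    ((embMeshGraph_adj_iff _ _).1 hmesh').1 (hDh (embMeshDomain_subset _ _ _ _ hcM))
  have hnd : γ.walk.darts.Nodup := SimpleGraph.Walk.darts_nodup_of_support_nodup γ.isPath.support_nodup
  have hedges : (γ.walk.darts.map SimpleGraph.Dart.edge).Nodup := γ.isPath.isTrail.edges_nodup
  have hinj := (List.nodup_map_iff_inj_on hnd).1 hedges d hdγ d' hd'
  have hdd' : d = d' := by
    apply hinj
    have e1 : d.fst = d'.snd := by rw [hceq]; exact ha'eq
    have e2 : d.snd = d'.fst := by rw [hd'1]; exact hb'.symm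
    show s(d.fst, d.snd) = s(d'.fst, d'.snd)
    rw [e1, e2]
    exact Sym2.eq_swap
  have : a' = (x, (1 : Fin 2)) := by
    show d.fst = (x, 1)
    rw [hdd', hd'1]
  exact hhex.ne this

/-- **The fixed-scale lower bound `Z_Λ ≤ P^{can}(γ ⊆ Λ ∪ {a,b}) · Z_L`.**  At a fixed mesh, let
`Λ ⊆ L` be finite vertex sets, `Λ` without bad edges of `D_δ` and with exact floor rows near the
floor points, `L` above the floor line with rows `≥ m`, closed under honeycomb steps to points of
`D` of row `≥ m`; let `a, b` be canonical floor endpoints with floor neighbours `u_a`, `u_b` and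
floor mid-edges `σa = {a, n(a)}`, `σb`.  Then the critical mass `Z_Λ(σa, σb)` of the inner family
is at most the canonical probability of staying in `Λ ∪ {a, b}` times `Z_L(σa, σb)`: the walks
inside `Λ` ARE canonical walks (no bad edges), and ALL canonical walks are walks in `L`
(`support_subset_of_closed`); the pendant end-steps contribute `x_c²` to both.
[cite: LawlerSchrammWerner2004SAW, §3.4 ("SAW satisfies restriction")] -/
theorem sum_le_measure_inside_mul_sum {D : DobrushinDomain} {δ ρ' : ℝ} {m : ℤ}
    {Λ L : Finset HexVertex} {a b ua ub wa wb : HexVertex}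
    [Fintype (HexDomainSAW D.carrier δ a b)] (hδ : 0 < δ)
    (hDh : D.carrier ⊆ {z : ℂ | (D.pt 0).im < z.im})
    (hm1 : ((m : ℝ) - 2 / 3) * (δ * (Real.sqrt 3 / 2)) ≤ (D.pt 0).im)
    (hm2 : (D.pt 0).im < ((m : ℝ) + 1 / 3) * (δ * (Real.sqrt 3 / 2)))
    (hΛbad : ∀ v ∈ Λ, ∀ w ∈ Λ, hexGraph.Adj v w → (hexDomainGraph D.carrier δ).Adj v w)
    (hΛL : Λ ⊆ L)
    (hcl : ∀ v ∈ L, ∀ w : HexVertex, (δ : ℂ) * hexCenter w ∈ D.carrier → m ≤ w.1 1 →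
      hexGraph.Adj v w → w ∈ L)
    (hLh : ∀ v ∈ L, (D.pt 0).im < ((δ : ℂ) * hexCenter v).im) (hLrow : ∀ v ∈ L, m ≤ v.1 1)
    (hrows : ∀ v : HexVertex, (δ : ℂ) * hexCenter v ∈ ball (D.pt 0) ρ' ∪ ball (D.pt 1) ρ' →
      m ≤ v.1 1 → v ∈ Λ)
    (hBa : ∀ w : HexVertex, (w = a ∨ hexGraph.Adj a w) → (δ : ℂ) * hexCenter w ∈ ball (D.pt 0) ρ')
    (hBb : ∀ w : HexVertex, (w = b ∨ hexGraph.Adj b w) → (δ : ℂ) * hexCenter w ∈ ball (D.pt 1) ρ')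
    (hua : hexGraph.Adj a ua) (huaim : ((δ : ℂ) * hexCenter ua).im ≤ (D.pt 0).im)
    (hub : hexGraph.Adj b ub) (hubim : ((δ : ℂ) * hexCenter ub).im ≤ (D.pt 0).im)
    (haim : (D.pt 0).im < ((δ : ℂ) * hexCenter a).im) (hbim : (D.pt 0).im < ((δ : ℂ) * hexCenter b).im)
    (hwa : (hexDomainGraph D.carrier δ).Adj a wa) (hwb : (hexDomainGraph D.carrier δ).Adj b wb)
    (hab : a ≠ b)
    (hσne : s(a, if a.2 = 0 then ((a.1 - Pi.single 1 1, 1) : HexVertex) else (a.1 + Pi.single 1 1, 0)) ≠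
      s(b, if b.2 = 0 then ((b.1 - Pi.single 1 1, 1) : HexVertex) else (b.1 + Pi.single 1 1, 0))) :
    ∑ γ : HexMidEdgeSAW Λ
        s(a, if a.2 = 0 then ((a.1 - Pi.single 1 1, 1) : HexVertex) else (a.1 + Pi.single 1 1, 0))
        s(b, if b.2 = 0 then ((b.1 - Pi.single 1 1, 1) : HexVertex) else (b.1 + Pi.single 1 1, 0)),
        hexCriticalFugacity ^ γ.length ≤
      ((hexSAWLaw D.carrier δ a b) {γ | ∀ v ∈ γ.walk.support, v ∈ Λ ∨ v = a ∨ v = b}).toReal *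
      ∑ γ : HexMidEdgeSAW L
        s(a, if a.2 = 0 then ((a.1 - Pi.single 1 1, 1) : HexVertex) else (a.1 + Pi.single 1 1, 0))
        s(b, if b.2 = 0 then ((b.1 - Pi.single 1 1, 1) : HexVertex) else (b.1 + Pi.single 1 1, 0)),
        hexCriticalFugacity ^ γ.length := by
  classical
  set x := hexCriticalFugacity with hxdef
  have hx : 0 ≤ x := hexCriticalFugacity_pos_lt_one.1.le
  have hxpos : 0 < x := hexCriticalFugacity_pos_lt_one.1
  set In : Set (HexDomainSAW D.carrier δ a b) := {γ | ∀ v ∈ γ.walk.support, v ∈ Λ ∨ v = a ∨ v = b}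
    with hIn
  have hout : ∀ u : HexVertex, ((δ : ℂ) * hexCenter u).im ≤ (D.pt 0).im → u ∉ L :=
    fun u hu huL => (hLh u huL).not_ge hu
  -- every canonical walk is a `D`-mesh walk inside `L ∪ {a, b}`
  have hall : ∀ γ : HexDomainSAW D.carrier δ a b,
      ((∀ v ∈ γ.walk.support, v ∈ embMeshVertices hexCenter D.carrier δ) ∧
        ∀ e ∈ γ.walk.darts, (embMeshGraph hexGraph hexCenter D.carrier δ).Adj e.fst e.snd) ∧
      ∀ v ∈ γ.walk.support, v ∈ L ∨ v = a ∨ v = b := by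
    intro γ
    refine ⟨⟨fun v hv => ?_, fun e _ => ((embDomainGraph_adj_iff _ _).1 e.adj).1⟩,
      support_subset_of_closed hδ hDh hm1 hcl (fun v hv hvm => hΛL (hrows v (Or.inl hv) hvm)) hBa γ⟩
    by_cases hvb : v = b
    · rw [hvb]; exact embMeshDomain_subset _ _ _ _ (mem_embMeshDomain_of_adj hwb)
    · obtain ⟨e, he, rfl⟩ := exists_dart_fst_eq γ.walk hv hvb
      exact embMeshDomain_subset _ _ _ _ (mem_embMeshDomain_of_adj e.adj)
  -- the law as a ratio
  have hP : ((hexSAWLaw D.carrier δ a b) In).toReal *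
      ∑ γ : HexDomainSAW D.carrier δ a b, x ^ γ.vertexCount =
      ∑ γ : HexDomainSAW D.carrier δ a b,
        if ∀ v ∈ γ.walk.support, v ∈ Λ ∨ v = a ∨ v = b then x ^ γ.vertexCount else 0 := by
    rw [hexSAWLaw_apply_toReal_eq_div, ← hxdef, Finset.sum_filter]
    rcases eq_or_lt_of_le (Finset.sum_nonneg fun γ _ => pow_nonneg hx γ.vertexCount :
      (0 : ℝ) ≤ ∑ γ : HexDomainSAW D.carrier δ a b, x ^ γ.vertexCount) with h0 | h0
    · rw [← h0, mul_zero]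
      refine (Finset.sum_eq_zero fun γ _ => ?_).symm
      have := (Finset.sum_eq_zero_iff_of_nonneg fun γ _ => pow_nonneg hx γ.vertexCount).1 h0.symm γ
        (Finset.mem_univ _)
      split_ifs
      · exact this
      · rfl
    · rw [div_mul_cancel₀ _ h0.ne']
      refine Finset.sum_congr rfl fun γ _ => ?_
      by_cases h : ∀ v ∈ γ.walk.support, v ∈ Λ ∨ v = a ∨ v = b
      · rw [if_pos h, if_pos (show γ ∈ In from h)]
      · rw [if_neg h, if_neg (show γ ∉ In from h)]
  have hden : ∑ γ : HexDomainSAW D.carrier δ a b, x ^ γ.vertexCount =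
      ∑ γ : HexDomainSAW D.carrier δ a b,
        if ((∀ v ∈ γ.walk.support, v ∈ embMeshVertices hexCenter D.carrier δ) ∧
            ∀ e ∈ γ.walk.darts, (embMeshGraph hexGraph hexCenter D.carrier δ).Adj e.fst e.snd) ∧
          ∀ v ∈ γ.walk.support, v ∈ L ∨ v = a ∨ v = b then x ^ γ.vertexCount else 0 :=
    Finset.sum_congr rfl fun γ _ => by rw [if_pos (hall γ)]
  have hclL : ∀ v ∈ L, ∀ w ∈ L, w ∈ embMeshVertices hexCenter D.carrier δ →
      (embMeshGraph hexGraph hexCenter D.carrier δ).Adj v w → w ∈ L := fun _ _ w hw _ _ => hw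
  rcases floor_cases_pair hδ hua haim huaim hub hbim hubim with
    ⟨ha0, hb0, hrowab, rfl, rfl⟩ | ⟨ha1, hb1, hrowab, hax, hbx⟩
  · -- full lowest row
    obtain ⟨-, hm, -⟩ | ⟨h1, -⟩ := floor_endpoint_cases hδ hm1 hm2 hua haim huaim
    swap
    · rw [ha0] at h1; exact absurd h1 (by decide)
    rw [if_pos ha0, if_pos hb0] at hσne ⊢
    have haΛ : a ∈ Λ := hrows a (Or.inl (hBa a (Or.inl rfl))) (by rw [hm])
    have hbΛ : b ∈ Λ := hrows b (Or.inr (hBb b (Or.inl rfl))) (by rw [hm, hrowab])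
    have huaL : (a.1 - Pi.single 1 1, (1 : Fin 2)) ∉ L := hout _ huaim
    have hubL : (b.1 - Pi.single 1 1, (1 : Fin 2)) ∉ L := hout _ hubim
    have hnum := sum_ite_inside_eq_sum (Ω := D.carrier) hΛbad haΛ hbΛ (fun h => huaL (hΛL h))
      (fun h => hubL (hΛL h)) hua hσne x
    have hle := sum_ite_meshEvent_inside_le_sum (Ω := D.carrier) (Ω' := D.carrier) (subset_refl L)
      hclL (hΛL haΛ) (hΛL hbΛ) huaL hubL hua hσne hx
    rw [← hden] at hle
    calc ∑ γ : HexMidEdgeSAW Λ _ _, x ^ γ.length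
        = ∑ γ : HexDomainSAW D.carrier δ a b,
            if ∀ v ∈ γ.walk.support, v ∈ Λ ∨ v = a ∨ v = b then x ^ γ.vertexCount else 0 := hnum.symm
      _ = ((hexSAWLaw D.carrier δ a b) In).toReal *
            ∑ γ : HexDomainSAW D.carrier δ a b, x ^ γ.vertexCount := hP.symm
      _ ≤ _ := mul_le_mul_of_nonneg_left hle ENNReal.toReal_nonneg
  · -- pendant lowest row
    obtain ⟨h0, -⟩ | ⟨-, hm, -⟩ := floor_endpoint_cases hδ hm1 hm2 hua haim huaim
    · rw [ha1] at h0; exact absurd h0 (by decide)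
    have h10a : ¬ a.2 = 0 := by rw [ha1]; decide
    have h10b : ¬ b.2 = 0 := by rw [hb1]; decide
    rw [if_neg h10a, if_neg h10b] at hσne ⊢
    have ha_eq : a = (a.1, (1 : Fin 2)) := Prod.ext rfl ha1
    have hb_eq : b = (b.1, (1 : Fin 2)) := Prod.ext rfl hb1
    have hka : ∀ w, (hexDomainGraph D.carrier δ).Adj a w → w = (a.1 + Pi.single 1 1, 0) := fun w hw =>
      floor_pendant_neighbour hδ hax (ha_eq ▸ embDomainGraph_le _ _ _ _ hw)
        (hDh (embMeshDomain_subset _ _ _ _ (mem_embMeshDomain_of_adj hw.symm)))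
    have hkb : ∀ w, (hexDomainGraph D.carrier δ).Adj b w → w = (b.1 + Pi.single 1 1, 0) := fun w hw =>
      floor_pendant_neighbour hδ hbx (hb_eq ▸ embDomainGraph_le _ _ _ _ hw)
        (hDh (embMeshDomain_subset _ _ _ _ (mem_embMeshDomain_of_adj hw.symm)))
    have haa' : (hexDomainGraph D.carrier δ).Adj a (a.1 + Pi.single 1 1, 0) := hka wa hwa ▸ hwa
    have hbb' : (hexDomainGraph D.carrier δ).Adj b (b.1 + Pi.single 1 1, 0) := hkb wb hwb ▸ hwb
    have huniqa : ∀ w, (hexDomainGraph D.carrier δ).Adj a w ↔ w = (a.1 + Pi.single 1 1, 0) :=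
      fun w => ⟨hka w, fun h => h ▸ haa'⟩
    have huniqb : ∀ w, (hexDomainGraph D.carrier δ).Adj b w ↔ w = (b.1 + Pi.single 1 1, 0) :=
      fun w => ⟨hkb w, fun h => h ▸ hbb'⟩
    have hadja : hexGraph.Adj a (a.1 + Pi.single 1 1, 0) := embDomainGraph_le _ _ _ _ haa'
    have hadjb : hexGraph.Adj b (b.1 + Pi.single 1 1, 0) := embDomainGraph_le _ _ _ _ hbb'
    have ha'Λ : ((a.1 + Pi.single 1 1, 0) : HexVertex) ∈ Λ :=
      hrows _ (Or.inl (hBa _ (Or.inr hadja))) (by simp [hm])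
    have hb'Λ : ((b.1 + Pi.single 1 1, 0) : HexVertex) ∈ Λ :=
      hrows _ (Or.inr (hBb _ (Or.inr hadjb))) (by simp [hm, hrowab])
    have haL : a ∉ L := fun h => by have := hLrow a h; omega
    have hbL : b ∉ L := fun h => by have := hLrow b h; rw [hrowab] at this; omega
    have ha'b : ((a.1 + Pi.single 1 1, 0) : HexVertex) ≠ b := fun h => hbL (hΛL (h ▸ ha'Λ))
    have hσne' : s(((a.1 + Pi.single 1 1, 0) : HexVertex), a) ≠ s(((b.1 + Pi.single 1 1, 0) : HexVertex), b) := by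
      rw [Sym2.eq_swap (a := (a.1 + Pi.single 1 1, 0)), Sym2.eq_swap (a := (b.1 + Pi.single 1 1, 0))]
      exact hσne
    have hnum := sum_ite_inside_eq_sq_mul_sum (Ω := D.carrier) hΛbad hab (fun h => haL (hΛL h))
      (fun h => hbL (hΛL h)) ha'Λ ha'b huniqa huniqb x
    have hle := sum_ite_meshEvent_inside_le_sq_mul_sum (Ω := D.carrier) (Ω' := D.carrier)
      (subset_refl L) hclL hab haL hbL (hΛL ha'Λ) (hΛL hb'Λ) ha'b huniqa huniqb hx
    rw [← hden] at hle
    have hx2 : 0 < x ^ 2 := by positivity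
    rw [Sym2.eq_swap (a := a), Sym2.eq_swap (a := b)]
    have key : x ^ 2 * ∑ γ : HexMidEdgeSAW Λ s(((a.1 + Pi.single 1 1, 0) : HexVertex), a)
        s(((b.1 + Pi.single 1 1, 0) : HexVertex), b), x ^ γ.length ≤
        ((hexSAWLaw D.carrier δ a b) In).toReal * (x ^ 2 *
          ∑ γ : HexMidEdgeSAW L s(((a.1 + Pi.single 1 1, 0) : HexVertex), a)
            s(((b.1 + Pi.single 1 1, 0) : HexVertex), b), x ^ γ.length) := by
      calc x ^ 2 * ∑ γ : HexMidEdgeSAW Λ _ _, x ^ γ.length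
          = ∑ γ : HexDomainSAW D.carrier δ a b,
              if ∀ v ∈ γ.walk.support, v ∈ Λ ∨ v = a ∨ v = b then x ^ γ.vertexCount else 0 := hnum.symm
        _ = ((hexSAWLaw D.carrier δ a b) In).toReal *
              ∑ γ : HexDomainSAW D.carrier δ a b, x ^ γ.vertexCount := hP.symm
        _ ≤ _ := mul_le_mul_of_nonneg_left hle ENNReal.toReal_nonneg
    rw [mul_left_comm] at key
    exact le_of_mul_le_mul_left key hx2

/-- A quantity `≤ 1` which, for every `ε > 0`, is eventually above a quantity converging to at
least `1 - ε` tends to `1`. [folklore] -/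
theorem tendsto_one_of_ratio_squeeze_le {l : Filter ℝ} {r : ℝ → ℝ} (h1 : ∀ᶠ δ in l, r δ ≤ 1)
    (h2 : ∀ ε : ℝ, 0 < ε → ∃ (g : ℝ → ℝ) (c : ℝ), 1 - ε ≤ c ∧ Tendsto g l (𝓝 c) ∧
      ∀ᶠ δ in l, g δ ≤ r δ) : Tendsto r l (𝓝 1) := by
  refine Metric.tendsto_nhds.2 fun ε hε => ?_
  obtain ⟨g, c, hc, hg, hrg⟩ := h2 (ε / 2) (half_pos hε)
  filter_upwards [h1, hrg, Metric.tendsto_nhds.1 hg _ (half_pos hε)] with δ hr1 hrg hgc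
  rw [Real.dist_eq, abs_sub_lt_iff] at hgc ⊢
  constructor <;> linarith [hgc.2]

/-- **Registered sub-goal `stub_canonicalTransfer_squeezeLe`** (crux item stmt-CriticalPhenomena-10472,
stub `stub_canonicalTransfer`): registry form of `tendsto_one_of_ratio_squeeze_le`. [folklore] -/
theorem stub_canonicalTransfer_squeezeLe :
    ∀ (l : Filter ℝ) (r : ℝ → ℝ), (∀ᶠ δ in l, r δ ≤ 1) →
    (∀ ε : ℝ, 0 < ε → ∃ (g : ℝ → ℝ) (c : ℝ), 1 - ε ≤ c ∧ Tendsto g l (𝓝 c) ∧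
      ∀ᶠ δ in l, g δ ≤ r δ) → Tendsto r l (𝓝 1) :=
  fun _ _ h1 h2 => tendsto_one_of_ratio_squeeze_le h1 h2

end Summit.CriticalPhenomena.SAWScalingLimit.Theorems.ObservableToSLE.FloorRatio

end
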